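import Summits.CriticalPhenomena.CardyFormulaZ2.Theorems.CardyComplexConeEdgePrecompactCollarAgreement

/-!
# Uniform forward response stability from arm domination: the collar summation
(line `qkz-strip-boundary-arm` of crux `CardyComplexCone.EdgePrecompact`, stmt-CriticalPhenomena-11387;
item 5 of the road map for the uniform forward response stability "UFRS", module docstring of
`Theorems/CardyComplexConeEdgePrecompactUniformForwardResponseStability.lean`)

The UFRS clause for ONE Dobrushin domain `D` (verbatim the body of the registered stub
`stub_uniformForwardResponseStability` at `D`) is derived here from four explicit hypotheses, which
isolate exactly what remains to be proved and for which class of domains it can be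
(`ufrs_of_armDomination`, registered sub-goal; a CONDITIONAL theorem — its hypotheses (H₁), (H₂),
(H₂') are not proved in the tree, (H₃) is a genuine restriction on `D`):

* (H₁) ARM DOMINATION (deterministic; items 3–4 of the road map, the planar topology of the strands
  of `…EdgePrecompactUFRSStrands.lean` / `…UFRSFailureStructure.lean`, NOT proved): there are two
  families of events, `A E w z r R` ("Dobrushin boundary three-arm event of the pair of data
  `E`, `shiftData E w` across the annulus `A(z; r, R)`") and `B E w η ρ` ("two-arm events at the
  marked points"), such that for every `η > 0`, for fine enough admissible data, every forward-response
  failure at a ball `B(E.δ v, ρ)` (`4η ≤ ρ`, centre `2ρ`-deep, shift `‖E.δ w‖ < η`) lies in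
  `A E w z (4η) (ρ/2)` for some point `z ∈ D` of the `3η`-collar, or in `B E w η ρ`.
* (Hm) MONOTONICITY of `A` in the annulus: `A E w z r R ⊆ A E w z' r' R'` whenever
  `A(z'; r', R') ⊆ A(z; r, R)` (`dist z' z + r ≤ r'`, `R' + dist z' z ≤ R`) — automatic for
  annulus-crossing events.
* (H₂) BOUNDARY THREE-ARM DECAY with exponent `1 + α` (probabilistic; the flat case is the tree's
  `Z2HalfPlane.real_threeArm_le`, Lawler–Schramm–Werner 2002, Appendix A; its transfer to `D` is NOT
  proved and is where the geometry of `∂D` near the box enters): `P(A E w z r R) ≤ C (r/R)^{1+α}` for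
  centres `z` within `r` of `Dᶜ`, shifts `‖E.δ w‖ < r`, fine enough data; and (H₂') decay `C (η/ρ)^α` of
  `B E w η ρ`.
* (H₃) BOX COUNT of `∂D` (the RESTRICTION on `D`): the `3η`-collar of `D` is covered by at most
  `L η^{-s}` balls of radius `η`, with `s < 1 + α` (rectifiable boundaries: `s = 1`).

Conclusion: the UFRS clause for `D`. Proof: cover the collar (H₃), move each dominating event to a
covering centre (Hm: annulus `A(z'; 5η, ρ/2 - η) ⊆ A(z; 4η, ρ/2)`), union bound
`P ≤ L η^{-s} · C (20 η/ρ)^{1+α} + C (η/ρ)^α`, which tends to `0` with `η` since `1 + α - s > 0`.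
This is the summation of item 5; item 6 of the road map explains why (H₃) with `s < 1 + α` fails
for rough Jordan curves and what should replace the union bound there.

References: G. F. Lawler, O. Schramm, W. Werner, Electron. J. Probab. 7 (2002), Appendix A;
P. Nolin, Electron. J. Probab. 13 (2008), §4; S. Smirnov, C. R. Acad. Sci. Paris 333 (2001), §2.
-/

namespace Summit.CriticalPhenomena.CardyFormulaZ2.Cruxes.EdgePrecompact.QkzStripBoundaryArm

open MeasureTheory Filter Set Metric
open scoped Topology BigOperators Pointwise
open Literature.Probability.LatticeModels Literature.Probability.Percolation
open Literature.Probability.RandomPlanarGeometry (DobrushinDomain)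
open Summit.CriticalPhenomena.CardyFormulaZ2.Theses.CardyComplexCone

noncomputable section

/-! ## Two elementary facts -/

/-- A point of a compact `K` with `cthickening (2ρ) K ⊆ D` is `2ρ`-deep in `D`. -/
theorem two_rho_le_infDist (D : DobrushinDomain) {K : Set ℂ} {ρ : ℝ}
    (hρK : cthickening (2 * ρ) K ⊆ D.carrier) {z : ℂ} (hz : z ∈ K) :
    2 * ρ ≤ infDist z D.carrierᶜ := by
  have hne : D.carrierᶜ.Nonempty := by
    obtain ⟨r, hr⟩ := D.isBounded.subset_closedBall 0
    refine ⟨((|r| + 1 : ℝ) : ℂ), fun h => ?_⟩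
    have h1 := hr h
    rw [mem_closedBall, dist_zero_right, Complex.norm_real, Real.norm_eq_abs,
      abs_of_pos (by positivity : (0:ℝ) < |r| + 1)] at h1
    linarith [le_abs_self r]
  refine (le_infDist hne).2 fun y hy => ?_
  by_contra hlt
  rw [not_le] at hlt
  exact hy (hρK (mem_cthickening_of_dist_le y z (2 * ρ) K hz (by rw [dist_comm]; exact hlt.le)))

/-- The rate of the collar summation tends to zero with `η`: for `0 < α`, `s < 1 + α`,
`M η^{1+α-s} + C (η/ρ)^α → 0` as `η → 0⁺`. -/
theorem tendsto_collarRate {M C ρ α s : ℝ} (hα : 0 < α) (hs : s < 1 + α) :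
    Tendsto (fun η : ℝ => M * η ^ (1 + α - s) + C * (η / ρ) ^ α) (𝓝[>] 0) (𝓝 0) := by
  have h1 : Tendsto (fun η : ℝ => η ^ (1 + α - s)) (𝓝 0) (𝓝 0) := by
    have := (Real.continuousAt_rpow_const 0 (1 + α - s) (Or.inr (by linarith))).tendsto
    rwa [Real.zero_rpow (by linarith)] at this
  have h2 : Tendsto (fun η : ℝ => (η / ρ) ^ α) (𝓝 0) (𝓝 0) := by
    have hc : Tendsto (fun η : ℝ => η / ρ) (𝓝 0) (𝓝 (0 / ρ)) := tendsto_id.div_const ρ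
    rw [zero_div] at hc
    have := (Real.continuousAt_rpow_const 0 α (Or.inr hα.le)).tendsto.comp hc
    rwa [Function.comp_def, Real.zero_rpow hα.ne'] at this
  have := (h1.const_mul M).add (h2.const_mul C)
  rw [mul_zero, mul_zero, add_zero] at this
  exact this.mono_left nhdsWithin_le_nhds

/-! ## The summation theorem -/

/-- **UFRS for `D` from arm domination, boundary three-arm decay and a box count of `∂D`**
(registered sub-goal `ufrs_of_armDomination` of stmt-CriticalPhenomena-11387; item 5 of the UFRS
road map; CONDITIONAL on its hypotheses (H₁) arm domination, (Hm) monotonicity, (H₂)/(H₂') arm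
decay, (H₃) box count — see the module docstring). The conclusion is verbatim the clause of
`stub_uniformForwardResponseStability` at the domain `D`. -/
theorem ufrs_of_armDomination : ∀ (D : DobrushinDomain) (A : DiscreteDobrushin → Site 2 → ℂ → ℝ → ℝ → Set (BondConfig (Site 2))) (B : DiscreteDobrushin → Site 2 → ℝ → ℝ → Set (BondConfig (Site 2))) (C α L s : ℝ), 0 < α → s < 1 + α → (∀ η > (0:ℝ), ∃ δ₀ > (0:ℝ), ∀ E : DiscreteDobrushin, E.Ω = D.carrier → E.IsZdAdmissible → E.δ < δ₀ → ∀ (v w : Site 2) (ρ : ℝ), 4 * η ≤ ρ → 2 * ρ ≤ infDist (meshPoint E.δ v) D.carrierᶜ → ‖meshPoint E.δ w‖ < η → ∀ ω : BondConfig (Site 2), (¬ ∀ a a' : Site 2 × Fin 4, ((E.IsStartCorner a ∧ (shiftData E w).IsStartCorner a') ∨ (a = a' ∧ medialPoint E.δ (cSrc a) ∈ ball (meshPoint E.δ v) ρ ∧ medialPoint E.δ (cTgt a) ∉ ball (meshPoint E.δ v) ρ)) → ∀ n : ℕ, (∀ i < n, medialPoint E.δ (cTgt (cornerOrbit (E.bcBondConfig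 ω) a i)) ∉ ball (meshPoint E.δ v) ρ ∧ E.IsInnerFace (cFace (cornerOrbit (E.bcBondConfig ω) a (i + 1)))) → medialPoint E.δ (cTgt (cornerOrbit (E.bcBondConfig ω) a n)) ∈ ball (meshPoint E.δ v) ρ → ∃ n' : ℕ, (∀ i < n', medialPoint E.δ (cTgt (cornerOrbit ((shiftData E w).bcBondConfig ω) a' i)) ∉ ball (meshPoint E.δ v) ρ ∧ (shiftData E w).IsInnerFace (cFace (cornerOrbit ((shiftData E w).bcBondConfig ω) a' (i + 1)))) ∧ cornerOrbit ((shiftData E w).bcBondConfig ω) a' n' = cornerOrbit (E.bcBondConfig ω) a n ∧ ∑ i ∈ Finset.range n', turnOf ((shiftData E w).bcBondConfig ω) (cornerOrbit ((shiftData E w).bcBondConfig ω) a' i) = ∑ i ∈ Finset.range n, turnOf (E.bcBondConfig ω) (cornerOrbit (E.bcBondConfig ω) a i)) → (∃ z ∈ D.carrier, infDist z D.carrierᶜ < 3 * η ∧ ω ∈ A E w z (4 * η) (ρ / 2)) ∨ ω ∈ B E w η ρ) → (∀ (E : DiscreteDobrushin) (w : Site 2) (z z' : ℂ) (r r' R R'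 : ℝ), dist z' z + r ≤ r' → R' + dist z' z ≤ R → A E w z r R ⊆ A E w z' r' R') → (∀ r R : ℝ, 0 < r → r < R → ∃ δ₀ > (0:ℝ), ∀ E : DiscreteDobrushin, E.Ω = D.carrier → E.IsZdAdmissible → E.δ < δ₀ → ∀ (w : Site 2) (z : ℂ), ‖meshPoint E.δ w‖ < r → infDist z D.carrierᶜ ≤ r → (bondPercolation (zdGraph 2) half).real (A E w z r R) ≤ C * (r / R) ^ (1 + α)) → (∀ η ρ : ℝ, 0 < η → η < ρ → ∃ δ₀ > (0:ℝ), ∀ E : DiscreteDobrushin, E.Ω = D.carrier → E.IsZdAdmissible → E.δ < δ₀ → ∀ w : Site 2, ‖meshPoint E.δ w‖ < η → (bondPercolation (zdGraph 2) half).real (B E w η ρ) ≤ C * (η / ρ) ^ α) → (∀ η : ℝ, 0 < η → η ≤ 1 → ∃ S : Finset ℂ, (S.card : ℝ) ≤ L * η ^ (-s) ∧ ∀ z ∈ D.carrier, infDist z D.carrierᶜ < 3 * η → ∃ z' ∈ S, dist z' z ≤ η) → ∀ K : Set ℂ, IsCompact K → K ⊆ D.carrier → ∀ ρ > (0:ℝ),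 cthickening (2 * ρ) K ⊆ D.carrier → ∀ ε > (0:ℝ), ∃ η > (0:ℝ), ∃ δ₀ > (0:ℝ), ∀ E : DiscreteDobrushin, E.Ω = D.carrier → E.IsZdAdmissible → E.δ < δ₀ → ∀ v w : Site 2, meshPoint E.δ v ∈ K → ‖meshPoint E.δ w‖ < η → (bondPercolation (zdGraph 2) half).real {ω : BondConfig (Site 2) | ¬ ∀ a a' : Site 2 × Fin 4, ((E.IsStartCorner a ∧ (shiftData E w).IsStartCorner a') ∨ (a = a' ∧ medialPoint E.δ (cSrc a) ∈ ball (meshPoint E.δ v) ρ ∧ medialPoint E.δ (cTgt a) ∉ ball (meshPoint E.δ v) ρ)) → ∀ n : ℕ, (∀ i < n, medialPoint E.δ (cTgt (cornerOrbit (E.bcBondConfig ω) a i)) ∉ ball (meshPoint E.δ v) ρ ∧ E.IsInnerFace (cFace (cornerOrbit (E.bcBondConfig ω) a (i + 1)))) → medialPoint E.δ (cTgt (cornerOrbit (E.bcBondConfig ω) a n)) ∈ ball (meshPoint E.δ v) ρ → ∃ n' : ℕ, (∀ i < n', medialPoint E.δ (cTgt (cornerOrbit ((shiftData E w).bcBondConfig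 ω) a' i)) ∉ ball (meshPoint E.δ v) ρ ∧ (shiftData E w).IsInnerFace (cFace (cornerOrbit ((shiftData E w).bcBondConfig ω) a' (i + 1)))) ∧ cornerOrbit ((shiftData E w).bcBondConfig ω) a' n' = cornerOrbit (E.bcBondConfig ω) a n ∧ ∑ i ∈ Finset.range n', turnOf ((shiftData E w).bcBondConfig ω) (cornerOrbit ((shiftData E w).bcBondConfig ω) a' i) = ∑ i ∈ Finset.range n, turnOf (E.bcBondConfig ω) (cornerOrbit (E.bcBondConfig ω) a i)} ≤ ε := by
  intro D A B C α L s hα hs hDom hMono hA hB hBox K _hK _hKD ρ hρ hρK ε hε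
  set μ := bondPercolation (zdGraph 2) half with hμ
  -- the rate, and a scale `η` at which it is below `ε`
  set M : ℝ := L * (C * (20 / ρ) ^ (1 + α)) with hM
  have hrate := tendsto_collarRate (M := M) (C := C) (ρ := ρ) hα hs
  have hev : ∀ᶠ η in 𝓝[>] (0:ℝ), M * η ^ (1 + α - s) + C * (η / ρ) ^ α < ε :=
    hrate (Iio_mem_nhds hε)
  have hsmall : ∀ᶠ η in 𝓝[>] (0:ℝ), η ∈ Ioo (0:ℝ) (min (ρ / 20) 1) :=
    Ioo_mem_nhdsGT (lt_min (by positivity) one_pos)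
  obtain ⟨η, hηε, hη0, hηmin⟩ := (hev.and hsmall).exists
  have hηρ : η < ρ / 20 := lt_of_lt_of_le hηmin (min_le_left _ _)
  have hη1 : η ≤ 1 := (lt_of_lt_of_le hηmin (min_le_right _ _)).le
  -- the mesh threshold
  obtain ⟨δ₁, hδ₁, hDom₁⟩ := hDom η hη0
  obtain ⟨δ₂, hδ₂, hA₂⟩ := hA (5 * η) (ρ / 2 - η) (by positivity) (by linarith)
  obtain ⟨δ₃, hδ₃, hB₃⟩ := hB η ρ hη0 (by linarith)
  obtain ⟨S, hScard, hScov⟩ := hBox η hη0 hη1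
  refine ⟨η, hη0, min δ₁ (min δ₂ δ₃), lt_min hδ₁ (lt_min hδ₂ hδ₃), ?_⟩
  intro E hEΩ hE hEδ v w hvK hw
  have hEδ₁ : E.δ < δ₁ := lt_of_lt_of_le hEδ (min_le_left _ _)
  have hEδ₂ : E.δ < δ₂ := lt_of_lt_of_le hEδ ((min_le_right _ _).trans (min_le_left _ _))
  have hEδ₃ : E.δ < δ₃ := lt_of_lt_of_le hEδ ((min_le_right _ _).trans (min_le_right _ _))
  have hv : 2 * ρ ≤ infDist (meshPoint E.δ v) D.carrierᶜ := two_rho_le_infDist D hρK hvK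
  -- the covering centres near the collar
  classical
  set S' := S.filter (fun z' => infDist z' D.carrierᶜ ≤ 5 * η) with hS'
  -- domination: the failure event lies in the union of the moved arm events and `B`
  have hsub : {ω : BondConfig (Site 2) | ¬ ∀ a a' : Site 2 × Fin 4, ((E.IsStartCorner a ∧ (shiftData E w).IsStartCorner a') ∨ (a = a' ∧ medialPoint E.δ (cSrc a) ∈ ball (meshPoint E.δ v) ρ ∧ medialPoint E.δ (cTgt a) ∉ ball (meshPoint E.δ v) ρ)) → ∀ n : ℕ, (∀ i < n, medialPoint E.δ (cTgt (cornerOrbit (E.bcBondConfig ω) a i)) ∉ ball (meshPoint E.δ v) ρ ∧ E.IsInnerFace (cFace (cornerOrbit (E.bcBondConfig ω) a (i + 1)))) → medialPoint E.δ (cTgt (cornerOrbit (E.bcBondConfig ω) a n)) ∈ ball (meshPoint E.δ v) ρ → ∃ n' : ℕ, (∀ i < n', medialPoint E.δ (cTgt (cornerOrbit ((shiftData E w).bcBondConfig ω) a' i)) ∉ ball (meshPoint E.δ v) ρ ∧ (shiftData E w).IsInnerFace (cFace (cornerOrbit ((shiftData E w).bcBondConfig ω) a' (i + 1)))) ∧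 cornerOrbit ((shiftData E w).bcBondConfig ω) a' n' = cornerOrbit (E.bcBondConfig ω) a n ∧ ∑ i ∈ Finset.range n', turnOf ((shiftData E w).bcBondConfig ω) (cornerOrbit ((shiftData E w).bcBondConfig ω) a' i) = ∑ i ∈ Finset.range n, turnOf (E.bcBondConfig ω) (cornerOrbit (E.bcBondConfig ω) a i)} ⊆
      (⋃ z' ∈ S', A E w z' (5 * η) (ρ / 2 - η)) ∪ B E w η ρ := by
    intro ω hω
    rcases hDom₁ E hEΩ hE hEδ₁ v w ρ (by linarith) hv hw ω hω with ⟨z, hzD, hzcol, hzA⟩ | hωB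
    · left
      obtain ⟨z', hz'S, hzz'⟩ := hScov z hzD hzcol
      have hz'S' : z' ∈ S' := by
        rw [hS', Finset.mem_filter]
        refine ⟨hz'S, ?_⟩
        have := infDist_le_infDist_add_dist (x := z') (y := z) (s := D.carrierᶜ)
        linarith
      refine Set.mem_biUnion (Finset.mem_coe.2 hz'S') ?_
      exact hMono E w z z' (4 * η) (5 * η) (ρ / 2) (ρ / 2 - η) (by linarith) (by linarith) hzA
    · exact Or.inr hωB
  -- the union bound
  have hratio : (5 * η) / (ρ / 2 - η) ≤ 20 * η / ρ := by
    rw [div_le_div_iff₀ (by linarith) hρ]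
    nlinarith [mul_pos hη0 hρ, mul_pos hη0 hη0]
  have hratio_nn : 0 ≤ (5 * η) / (ρ / 2 - η) := div_nonneg (by positivity) (by linarith)
  have hCnn : 0 ≤ C := by
    -- `C` bounds a probability at admissible data; if no admissible datum existed the bound below is
    -- not needed, so we argue directly from the term we must bound
    by_contra hC
    rw [not_le] at hC
    have h := hB₃ E hEΩ hE hEδ₃ w hw
    have : C * (η / ρ) ^ α < 0 := mul_neg_of_neg_of_pos hC (Real.rpow_pos_of_pos (by positivity) α)
    linarith [measureReal_nonneg (μ := μ) (s := B E w η ρ)]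
  have hterm : ∀ z' ∈ S', μ.real (A E w z' (5 * η) (ρ / 2 - η)) ≤ C * (20 * η / ρ) ^ (1 + α) := by
    intro z' hz'
    rw [hS', Finset.mem_filter] at hz'
    refine (hA₂ E hEΩ hE hEδ₂ w z' (by linarith) hz'.2).trans ?_
    exact mul_le_mul_of_nonneg_left
      (Real.rpow_le_rpow hratio_nn hratio (by linarith)) hCnn
  have hcard' : (S'.card : ℝ) ≤ L * η ^ (-s) :=
    le_trans (by exact_mod_cast Finset.card_filter_le _ _) hScard
  have hpow : η ^ (-s) * (20 * η / ρ) ^ (1 + α) = (20 / ρ) ^ (1 + α) * η ^ (1 + α - s) := by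
    have h1 : (20 * η / ρ) ^ (1 + α) = (20 / ρ) ^ (1 + α) * η ^ (1 + α) := by
      rw [show 20 * η / ρ = 20 / ρ * η by ring]
      exact Real.mul_rpow (by positivity) hη0.le
    have h2 : η ^ (1 + α - s) = η ^ (1 + α) * η ^ (-s) := by
      rw [sub_eq_add_neg, Real.rpow_add hη0]
    rw [h1, h2]; ring
  have hstep : (S'.card : ℝ) * (C * (20 * η / ρ) ^ (1 + α)) ≤ L * η ^ (-s) * (C * (20 * η / ρ) ^ (1 + α)) :=
    mul_le_mul_of_nonneg_right hcard' (mul_nonneg hCnn (by positivity))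
  calc μ.real _ ≤ μ.real ((⋃ z' ∈ S', A E w z' (5 * η) (ρ / 2 - η)) ∪ B E w η ρ) :=
        measureReal_mono hsub
    _ ≤ μ.real (⋃ z' ∈ S', A E w z' (5 * η) (ρ / 2 - η)) + μ.real (B E w η ρ) :=
        measureReal_union_le _ _
    _ ≤ ∑ z' ∈ S', μ.real (A E w z' (5 * η) (ρ / 2 - η)) + C * (η / ρ) ^ α :=
        add_le_add (measureReal_biUnion_finset_le _ _) (hB₃ E hEΩ hE hEδ₃ w hw)
    _ ≤ ∑ _z' ∈ S', C * (20 * η / ρ) ^ (1 + α) + C * (η / ρ) ^ α :=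
        add_le_add (Finset.sum_le_sum hterm) le_rfl
    _ = S'.card * (C * (20 * η / ρ) ^ (1 + α)) + C * (η / ρ) ^ α := by
        rw [Finset.sum_const, nsmul_eq_mul]
    _ ≤ L * η ^ (-s) * (C * (20 * η / ρ) ^ (1 + α)) + C * (η / ρ) ^ α :=
        add_le_add hstep le_rfl
    _ = M * η ^ (1 + α - s) + C * (η / ρ) ^ α := by
        rw [hM, show L * η ^ (-s) * (C * (20 * η / ρ) ^ (1 + α)) =
          L * C * (η ^ (-s) * (20 * η / ρ) ^ (1 + α)) by ring, hpow]
        ring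
    _ ≤ ε := hηε.le

end

end Summit.CriticalPhenomena.CardyFormulaZ2.Cruxes.EdgePrecompact.QkzStripBoundaryArm
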